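import Literature.NumberTheory.EllipticCurves.FormalGroupFrobeniusTypeAllPrimesProofs
import HarnessLib

/-!
# Honda's congruences for `log_E` in NUMERATOR form: `m ∣ b_m − [p∣m]·a_p·b_{m/p} + [p²∣m]·p·b_{m/p²}` in `ℤ_p`

Topic `NumberTheory/EllipticCurves` (theorems only; no definition, no named fact, no instance, no `sorry`). For a
Weierstrass equation `V/ℤ_p` with elliptic generic and special fibres write `log_V(X) = Σ_{m≥1} (b_m/m) Xᵐ` with
`b_m = m · coeff_m log_V ∈ ℤ_p` (`b_m` = the `(m−1)`-st coefficient of the `p`-integral invariant differential,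
`WeierstrassCurve.norm_natCast_mul_coeff_formalLog_le`). The tree's Atkin–Swinnerton-Dyer / Honda congruences
`hondaShift p a_p log_V ∈ ℤ_p⟦X⟧` (`WeierstrassCurve.norm_coeff_hondaShift_formalLog_le_one'`, every prime `p`,
`a_p = p + 1 − #Ṽ(𝔽_p)`) read coefficientwise (`coeff_hondaShift`): with
`B_m := b_m − [p∣m]·a_p·b_{m/p} + [p²∣m]·p·b_{m/p²}` one has **`m ∣ B_m` in `ℤ_p`** for every `m ≥ 1`:

* `exists_formalLog_numerators` — the numerators `b : ℕ → ℤ_p` exist;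
* ★ `exists_natCast_mul_eq_honda_numerator` — `∃ e : ℕ → ℤ_p, ∀ m ≥ 1, m·e_m = B_m`.

This is exactly the hypothesis `he` of the generic `p`-adic Honda / Frobenius-annihilation theorems
`RingTheory.FormalGroups.PadicLogSeries.exists_evalₐ_honda_eq` / `exists_evalₐ_frobenius_honda_eq` (φ-road of line
`kato_lever`, crux K★ `stmt-BirchSwinnertonDyer-22226`, memo `Lines/kato-lever-K2-phi-road.md`); BSD / K★ are not
proved by any of this.

## References
* T. Honda, *On the theory of commutative formal groups*, J. Math. Soc. Japan 22 (1970), Thm. 9 (pp. 240–241), Thm. 2 (p. 223). [Honda1970]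
* M. Hazewinkel, *Formal Groups and Applications* (1978), Ch. I §2.1, §33.1. [Hazewinkel1978]
* J. H. Silverman, *AEC* (2009), IV.5.5, IV.6.3. [SilvermanAEC2009]
-/

noncomputable section

open PowerSeries

namespace Literature.NumberTheory.EllipticCurves

variable {p : ℕ} [hp : Fact p.Prime] (V : WeierstrassCurve ℤ_[p]) [hE : (V.map PadicInt.Coe.ringHom).IsElliptic]
  [hEt : (V.map PadicInt.toZMod).IsElliptic]

omit hE hEt in
/-- **The numerators `b_m = m · coeff_m log_V ∈ ℤ_p`** of the formal logarithm of `V/ℤ_p` (`log_V = Σ (b_m/m)Xᵐ`,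
`b_{m}` = `(m−1)`-st coefficient of the invariant differential). [cite: SilvermanAEC2009, IV.5.5] -/
theorem exists_formalLog_numerators :
    ∃ b : ℕ → ℤ_[p], ∀ m : ℕ, (b m : ℚ_[p]) = (m : ℚ_[p]) * coeff m (V.map PadicInt.Coe.ringHom).formalLog := by
  haveI := V.isIntegral_map_coe
  exact ⟨fun m => ⟨(m : ℚ_[p]) * coeff m (V.map PadicInt.Coe.ringHom).formalLog,
    (V.map PadicInt.Coe.ringHom).norm_natCast_mul_coeff_formalLog_le m⟩, fun m => rfl⟩

/-- ★ **Honda's congruences in numerator form.** If `b_m = m · coeff_m log_V` (`m ≥ 0`) then for every `m ≥ 1`,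
`m` divides `B_m = b_m − [p∣m]·a_p·b_{m/p} + [p²∣m]·p·b_{m/p²}` in `ℤ_p`, `a_p = p + 1 − #Ṽ(𝔽_p)`: there is
`e : ℕ → ℤ_p` with `m · e_m = B_m` — `e_m` is the `m`-th coefficient of `hondaShift p a_p log_V ∈ ℤ_p⟦X⟧`
(`WeierstrassCurve.norm_coeff_hondaShift_formalLog_le_one'`). [cite: Honda1970, Thm. 9 (pp. 240–241)]
[cite: Hazewinkel1978, Ch. I §2.1] -/
theorem exists_natCast_mul_eq_honda_numerator (b : ℕ → ℤ_[p])
    (hb : ∀ m : ℕ, (b m : ℚ_[p]) = (m : ℚ_[p]) * coeff m (V.map PadicInt.Coe.ringHom).formalLog) :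
    ∃ e : ℕ → ℤ_[p], ∀ m : ℕ, m ≠ 0 → (m : ℤ_[p]) * e m =
      b m - (if p ∣ m then ((HasseManin.tr (V.map PadicInt.toZMod) : ℤ) : ℤ_[p]) * b (m / p) else 0) +
        (if p ^ 2 ∣ m then (p : ℤ_[p]) * b (m / p ^ 2) else 0) := by
  set ℓ := (V.map PadicInt.Coe.ringHom).formalLog with hℓ
  set a : ℤ := HasseManin.tr (V.map PadicInt.toZMod) with ha
  have hint := V.norm_coeff_hondaShift_formalLog_le_one'
  refine ⟨fun m => ⟨coeff m (Literature.RingTheory.FormalGroups.hondaShift p (a : ℚ_[p]) ℓ), hint m⟩, fun m hm => ?_⟩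
  have hp0 : (p : ℚ_[p]) ≠ 0 := by exact_mod_cast hp.out.ne_zero
  have hm0 : (m : ℚ_[p]) ≠ 0 := by exact_mod_cast hm
  -- compare in `ℚ_p`
  apply Subtype.ext
  push_cast
  rw [Literature.RingTheory.FormalGroups.coeff_hondaShift]
  -- the three coefficients in terms of `b`
  have h0 : (m : ℚ_[p]) * coeff m ℓ = (b m : ℚ_[p]) := (hb m).symm
  by_cases h1 : p ∣ m
  · obtain ⟨j, rfl⟩ := h1
    have hj : j ≠ 0 := by rintro rfl; exact hm (by simp)
    have hj0 : (j : ℚ_[p]) ≠ 0 := by exact_mod_cast hj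
    rw [if_pos (dvd_mul_right p j), if_pos (dvd_mul_right p j), Nat.mul_div_cancel_left j hp.out.pos]
    have hbj : coeff j ℓ = (b j : ℚ_[p]) / j := by rw [hb j]; field_simp
    by_cases h2 : p ^ 2 ∣ p * j
    · have h2' : p ∣ j := by
        rw [pow_two] at h2; exact Nat.dvd_of_mul_dvd_mul_left hp.out.pos h2
      obtain ⟨k, rfl⟩ := h2'
      have hk : k ≠ 0 := by rintro rfl; exact hj (by simp)
      have hk0 : (k : ℚ_[p]) ≠ 0 := by exact_mod_cast hk
      have hdiv : p * (p * k) / p ^ 2 = k := by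
        rw [pow_two, ← mul_assoc, Nat.mul_div_cancel_left k (Nat.mul_pos hp.out.pos hp.out.pos)]
      rw [if_pos h2, if_pos h2, hdiv]
      have hbk : coeff k ℓ = (b k : ℚ_[p]) / k := by rw [hb k]; field_simp
      rw [mul_add, mul_sub, h0, hbj, hbk]
      push_cast
      field_simp
    · rw [if_neg h2, if_neg h2, mul_add, mul_sub, h0, hbj]
      push_cast
      field_simp
      ring
  · have h2 : ¬ p ^ 2 ∣ m := fun h => h1 (dvd_trans (dvd_pow_self p two_ne_zero) h)
    rw [if_neg h1, if_neg h1, if_neg h2, if_neg h2, mul_add, mul_sub, h0]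
    push_cast
    ring

end Literature.NumberTheory.EllipticCurves

end
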